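import Summits.QuantumFields.YangMills.Theorems.UnitScaleTiltProp7CoerciveOfInverseBound
import Literature.Analysis.InnerProduct.PositiveOperatorInversePairing
import HarnessLib

/-!
# Route `UnitScaleTilt`, crux K1 «MinimiserStabilityRegPr» (stmt-QuantumFields-19200), EX rows `h137kπ` ∕ `h137kΔ` ∕ `hCk` (the three `(Q_kGQ_k*)⁻¹`-ENTRY rows of the S46∕S47 face) —
# **K-STOREY BRICK (K1a) (px12 g16, LOCATE-K137 529f36ee road (K1)): THE VARIATIONAL ROWS OF `K⁻¹ = (Q_kGQ_k*)⁻¹` ON THE CLASS** — `⟨ω, K⁻¹ω⟩` IS the `Δ_a`-energy of the minimiser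
# `Hω`, is `≤` the `Δ_a`-energy of ANY interpolant `A` with `Q_kA = ω`, splits as `re⟨Hω, ΔxHω⟩ + ‖R_SD*Hω‖² + a‖ω‖²` with the gauge penalty VANISHING under (3.124); and an
# ENERGY-BOUNDED RIGHT INVERSE `E` of `Q_k` (`Q_k(Ec) = c`, `re⟨Ec, Δ_aEc⟩ ≤ C_E‖c‖²`) makes `K` COERCIVE (`C_E⁻¹‖c‖² ≤ re⟨c, Kc⟩`) and bounds `‖K⁻¹ω‖ ≤ C_E‖ω‖`, `‖Kc‖ ≤ a⁻¹‖c‖`.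

Cell `ym3-torus` (HUMAN RULING D-0037: SU(2) YM₃ on T³ is ladder rung R3 — NOT d = 4, NOT infinite volume, NOT a mass gap, NOT Clay).  Width seat `ym3-torus-px12` gen 16 (explicit-unit
«width 12»; own LOCATE-K137, 19200 evidence 529f36eec2fd0cae, road (K1) «the ONE genuinely new estimate is a K-free right inverse of `Q_k` with bounded `Δ_a`-energy» — this file is the
DOOR that turns such an interpolant into the K-free bounds of `K` and `K⁻¹`, the one-form twin of the site line's ✓`Prop7CovariantBlockBumps.norm_le_of_energy_rightInverse` ⟶
✓`Prop7CoarseGramCoercivity.coarseGram_coercive`).  THEOREMS ONLY (0 `def`, 0 `sorry`); `--supports stmt-QuantumFields-19200 --as helper`, count-neutral.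
HONEST LABEL: abstract Hilbert-space rows over the total letters of ✓`Prop7SectET3CurvedPropagatorsT3` on the class `PosOnto` with a symmetric Hessian slot `Δx`; the interpolant `E` is a
HYPOTHESIS (brick (K1b), not here); nothing of (3.132), (3.137), `h137kπ`, `h137kΔ`, `hCk`, EX or 19200 is proved here.

THE MATHEMATICS (all on the class `PosOnto`, `Δx(U₀)` symmetric; `Q := Q_k(U₀)`, `G := Δ_a(U₀)⁻¹`, `K := QGQ†`, `K⁻¹ := KinvT`, `H := GQ†K⁻¹`).
* `Δ_a` is a POSITIVE operator (symmetric ✓`laplaceA_isSymmetric` + `0 < re⟨x, Δ_ax⟩` of the class), so the Cauchy–Schwarz inequality of its form (✓ lit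
  `Literature.Analysis.InnerProduct.norm_inner_sq_le_of_apply_eq`: `T ≥ 0`, `Tw = g` ⟹ `|⟨g, u⟩|² ≤ re⟨w, g⟩·re⟨Tu, u⟩`) is available with `T = Δ_a`.
* (§1) `w := GQ†c`, `g := Q†c`, `u := A` with `QA = c`: `⟨Q†c, A⟩ = ⟨c, QA⟩ = ‖c‖²` and `re⟨GQ†c, Q†c⟩ = re⟨c, Kc⟩`, so **`‖c‖⁴ ≤ re⟨c, Kc⟩·re⟨A, Δ_aA⟩`**; an interpolant with
  `re⟨Ec, Δ_aEc⟩ ≤ C_E‖c‖²` gives **`C_E⁻¹‖c‖² ≤ re⟨c, Kc⟩`**, whence (✓`inv_bound_of_coercive`, `K K⁻¹ = 1` ✓`Qk_GT_adjoint_KinvT`) **`‖K⁻¹ω‖ ≤ C_E‖ω‖`**.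
* (§2) `Δ_a(Hω) = Q†K⁻¹ω` and `QHω = ω` (✓`Qk_HT`) give **`⟨Hω, Δ_aHω⟩ = ⟨ω, K⁻¹ω⟩`** (as complex numbers); Cauchy–Schwarz with `w := Hω`, `g := Q†K⁻¹ω`, `u := A` gives the
  MINIMALITY **`re⟨ω, K⁻¹ω⟩ ≤ re⟨A, Δ_aA⟩` for every `A` with `QA = ω`** (print p.420: `Hω` is the minimiser of `⟨A, Δ_aA⟩` on `QA = ω`).
* (§4) EXACTNESS IS CHEAP: if `E₀` is only an APPROXIMATE right inverse (`‖QE₀c − c‖ ≤ ½‖c‖`) with energy `≤ C₀‖c‖²`, then `E := E₀(QE₀)⁻¹` is exact with energy `≤ 4C₀‖c‖²` —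
  the correction lives on the coarse side, so the block-constant `Q†` (derivative energy `O(η⁻¹)`) never enters; at the member `E₀` = the FLAT smooth interpolant, `Q_k(U₀)E₀ ≈ 1` on `RegPr`.
* (§3) ✓`re_inner_laplaceA_eq`: **`re⟨ω, K⁻¹ω⟩ = re⟨Hω, ΔxHω⟩ + ‖R_SD*Hω‖² + a‖ω‖²`**; under (3.124) (`Δx` kills `D N_S`, ✓`RS_DstarL2_GT_adjoint_Qk`) the middle term is `0`, so
  **`re⟨ω, (K⁻¹ − a)ω⟩ = re⟨Hω, ΔxHω⟩`** — the form behind (3.137)'s `Δ_πH = Q†K⁻¹ − Q†a`; if moreover `re⟨x, Δx x⟩ ≥ 0` then **`a‖ω‖² ≤ re⟨ω, K⁻¹ω⟩`** and **`‖Kc‖ ≤ a⁻¹‖c‖`**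
  (print: `QGQ* ≤ a⁻¹`).

WHAT IS PROVED (ns `Summit.QuantumFields.YangMills.Theorems.Prop7KinvVariationalRows`; every row on the class `hp : PosOnto …`, `hΔs : (Δx U₀).IsSymmetric` where the form is used).
* §1 `laplaceA_isPositive`, `re_inner_K_nonneg`, ★★ `norm_pow_four_le_re_inner_K_mul_energy`, ★★★ `coercive_K_of_energyRightInverse`, ★★★ `norm_KinvT_le_of_energyRightInverse`.
* §2 `laplaceA_HT_eq`, ★ `inner_HT_laplaceA_HT_eq`, `re_inner_KinvT_eq_energy_HT`, `re_inner_KinvT_nonneg`, ★★ `re_inner_KinvT_le_energy`, `re_inner_KinvT_le_of_energyRightInverse`.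
* §3 ★ `re_inner_KinvT_eq_three_terms`, `RS_DstarL2_HT_eq_zero`, ★★ `re_inner_KinvT_sub_penalty_eq` ((3.137)'s form), ★ `penalty_mul_normSq_le_re_inner_KinvT`, ★ `norm_K_le_of_nonneg`.
* §4 (abstract, then member) `exists_inverse_of_norm_sub_le_half`, ★★ `exists_exact_rightInverse_of_approx` (`E := E₀∘(QE₀)⁻¹`: exactness corrected on the COARSE side, energy `× 4`),
  ★★★ `norm_KinvT_le_of_approxRightInverse` (an APPROXIMATE smooth interpolant — flat-smooth `E₀`, `‖Q_k(U₀)E₀ − 1‖ ≤ ½` on `RegPr` — already gives `‖K⁻¹‖ ≤ 4C₀`, `K ≥ (4C₀)⁻¹`).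

References: T. Bałaban, CMP **99** (1985) 389–434 [Balaban1985BackgroundPropagators] ((3.26)–(3.27) p.395, (3.122)–(3.127) pp.420–421, (3.132) p.422, (3.137) p.423); CMP **102** (1985)
277–309 [Balaban1985Variational] ((45)–(46) p.285, (110) p.294); CMP **95** (1984) 17–40 [Balaban1984PropagatorsI] ((1.47)–(1.50) p.26: `H_kB` minimises `½⟨dA, dA⟩` on `Q_kA = B`);
J.-P. Demailly, *Complex Analytic and Differential Geometry* (2012) Ch. VIII §4 (the Cauchy–Schwarz row, via lit).
-/

set_option autoImplicit false

noncomputable section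

open scoped InnerProductSpace ComplexConjugate

namespace Summit.QuantumFields.YangMills.Theorems.Prop7KinvVariationalRows

open Literature.MathematicalPhysics.QuantumFieldTheory.Balaban1983to89
open Literature.MathematicalPhysics.QuantumFieldTheory.Balaban1983to89.T3ContinuumYM3Torus
open B11Eq103H1Complex (SiteL2K BondL2K)
open B9Eq311L2Pairing (WL2)
open Summit.QuantumFields.YangMills.Theorems.Prop7SectET3Transport (periodsT3)
open Summit.QuantumFields.YangMills.Theorems.Prop7SectET3HilbertLetters (W₂ DL2 DstarL2)
open Summit.QuantumFields.YangMills.Theorems.Prop7SectET3GaugeProjector (RS NS)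
open Summit.QuantumFields.YangMills.Theorems.Prop7SectET3CurvedPropagators (Qk laplaceA PosOnto GT KinvT HT HT_eq_comp laplaceA_GT Qk_GT_adjoint_KinvT Qk_HT)
open Summit.QuantumFields.YangMills.Theorems.Prop7SectET3OpsT3HilbertRows (laplaceA_isSymmetric RS_DstarL2_GT_adjoint_Qk)
open Summit.QuantumFields.YangMills.Theorems.Prop7CoerciveOfInverseBound (re_inner_laplaceA_eq inv_bound_of_coercive)
open Literature.Analysis.InnerProduct (norm_inner_sq_le_of_apply_eq)

variable {F : T3Family} {n K : ℕ} {h : n ≤ K} {c₀ cB a : ℝ} [Fact (0 < c₀)] [Fact (0 < cB)]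
  {Δx : GaugeField (F.P K) 0 (Matrix.specialUnitaryGroup (Fin 2) ℂ) → (BondL2K ℂ 3 (periodsT3 F K) c₀ W₂ →ₗ[ℂ] BondL2K ℂ 3 (periodsT3 F K) c₀ W₂)}
  {U₀ : GaugeField (F.P K) 0 (Matrix.specialUnitaryGroup (Fin 2) ℂ)}

/-! ## §1 `Δ_a ≥ 0`; `‖c‖⁴ ≤ re⟨c, Kc⟩·re⟨A, Δ_aA⟩` for every interpolant; coercivity of `K` and the bound of `K⁻¹` from an energy-bounded right inverse of `Q_k` -/

/-- **`Δ_a(U₀)` IS A POSITIVE OPERATOR ON THE CLASS** (Mathlib's `LinearMap.IsPositive`: symmetric with `0 ≤ re⟨Δ_ax, x⟩`) when the Hessian slot is symmetric — ✓`laplaceA_isSymmetric` and the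
class's `0 < re⟨x, Δ_ax⟩` (`x ≠ 0`). [cite: Balaban1985BackgroundPropagators, Thm 3.11 p.416, (3.26) p.395] -/
theorem laplaceA_isPositive (hp : PosOnto F n K h c₀ cB a Δx U₀) (hΔs : (Δx U₀).IsSymmetric) : (laplaceA F n K h c₀ cB a Δx U₀).IsPositive := by
  have hs : (laplaceA F n K h c₀ cB a Δx U₀).IsSymmetric := laplaceA_isSymmetric hΔs
  refine ⟨hs, fun x => ?_⟩
  by_cases hx : x = 0
  · rw [hx, map_zero, inner_zero_left, map_zero]
  · rw [hs x x]
    exact (hp.pos x hx).le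

/-- **`0 ≤ re⟨c, Kc⟩`, `K = Q_kGQ_k†`**: `re⟨c, QGQ†c⟩ = re⟨Q†c, GQ†c⟩ = re⟨Δ_a(GQ†c), GQ†c⟩ ≥ 0`. [cite: Balaban1985BackgroundPropagators, Thm 3.11 p.416, (3.126) p.420] -/
theorem re_inner_K_nonneg (hp : PosOnto F n K h c₀ cB a Δx U₀) (hΔs : (Δx U₀).IsSymmetric) (c : WL2 ℂ (fun _ : PBond (F.P n) 0 => cB) W₂) :
    0 ≤ RCLike.re ⟪c, Qk F n K h c₀ cB U₀ (GT F n K h c₀ cB a Δx U₀ (LinearMap.adjoint (Qk F n K h c₀ cB U₀) c))⟫_ℂ := by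
  have e1 : ⟪c, Qk F n K h c₀ cB U₀ (GT F n K h c₀ cB a Δx U₀ (LinearMap.adjoint (Qk F n K h c₀ cB U₀) c))⟫_ℂ
      = ⟪laplaceA F n K h c₀ cB a Δx U₀ (GT F n K h c₀ cB a Δx U₀ (LinearMap.adjoint (Qk F n K h c₀ cB U₀) c)),
          GT F n K h c₀ cB a Δx U₀ (LinearMap.adjoint (Qk F n K h c₀ cB U₀) c)⟫_ℂ := by
    rw [laplaceA_GT hp, ← LinearMap.adjoint_inner_left]
  rw [e1]
  exact (laplaceA_isPositive hp hΔs).2 _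

/-- ★★ **THE CAUCHY–SCHWARZ ROW OF `K`: `‖c‖⁴ ≤ re⟨c, Kc⟩·re⟨A, Δ_aA⟩` FOR EVERY `A` WITH `Q_kA = c`** — `‖c‖² = ⟨c, QA⟩ = ⟨Q†c, A⟩ = ⟨Δ_a(GQ†c), A⟩` and the Cauchy–Schwarz inequality of
the non-negative form of `Δ_a` (lit ✓`norm_inner_sq_le_of_apply_eq`). [cite: Balaban1985BackgroundPropagators, (3.126)–(3.127) pp.420–421, Thm 3.11 p.416] -/
theorem norm_pow_four_le_re_inner_K_mul_energy (hp : PosOnto F n K h c₀ cB a Δx U₀) (hΔs : (Δx U₀).IsSymmetric)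
    (c : WL2 ℂ (fun _ : PBond (F.P n) 0 => cB) W₂) (A : BondL2K ℂ 3 (periodsT3 F K) c₀ W₂) (hA : Qk F n K h c₀ cB U₀ A = c) :
    ‖c‖ ^ 4 ≤ RCLike.re ⟪c, Qk F n K h c₀ cB U₀ (GT F n K h c₀ cB a Δx U₀ (LinearMap.adjoint (Qk F n K h c₀ cB U₀) c))⟫_ℂ
      * RCLike.re ⟪A, laplaceA F n K h c₀ cB a Δx U₀ A⟫_ℂ := by
  have hw : laplaceA F n K h c₀ cB a Δx U₀ (GT F n K h c₀ cB a Δx U₀ (LinearMap.adjoint (Qk F n K h c₀ cB U₀) c)) = LinearMap.adjoint (Qk F n K h c₀ cB U₀) c :=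
    laplaceA_GT hp _
  have hcs := norm_inner_sq_le_of_apply_eq (laplaceA_isPositive hp hΔs) hw A
  have e1 : ⟪LinearMap.adjoint (Qk F n K h c₀ cB U₀) c, A⟫_ℂ = (((‖c‖ ^ 2 : ℝ)) : ℂ) := by
    rw [LinearMap.adjoint_inner_left, hA, inner_self_eq_norm_sq_to_K]
    norm_cast
  have e2 : RCLike.re ⟪GT F n K h c₀ cB a Δx U₀ (LinearMap.adjoint (Qk F n K h c₀ cB U₀) c), LinearMap.adjoint (Qk F n K h c₀ cB U₀) c⟫_ℂ
      = RCLike.re ⟪c, Qk F n K h c₀ cB U₀ (GT F n K h c₀ cB a Δx U₀ (LinearMap.adjoint (Qk F n K h c₀ cB U₀) c))⟫_ℂ := by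
    rw [LinearMap.adjoint_inner_right]
    exact inner_re_symm _ _
  have e3 : RCLike.re ⟪laplaceA F n K h c₀ cB a Δx U₀ A, A⟫_ℂ = RCLike.re ⟪A, laplaceA F n K h c₀ cB a Δx U₀ A⟫_ℂ := inner_re_symm _ _
  have e4 : ‖((((‖c‖ ^ 2 : ℝ)) : ℂ))‖ ^ 2 = ‖c‖ ^ 4 := by
    rw [Complex.norm_real, Real.norm_of_nonneg (sq_nonneg _)]
    ring
  rw [e1, e2, e3, e4] at hcs
  exact hcs

/-- ★★★ **COERCIVITY OF `K = Q_kGQ_k†` FROM AN ENERGY-BOUNDED RIGHT INVERSE OF `Q_k`**: if `E` satisfies `Q_k(Ec) = c` and `re⟨Ec, Δ_a(Ec)⟩ ≤ C_E‖c‖²` for all `c` (`0 < C_E`), then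
`C_E⁻¹‖c‖² ≤ re⟨c, Kc⟩` for all `c` — the one-form twin of the site line's (L4′) ✓`norm_le_of_energy_rightInverse`; K-free exactly when `C_E` is.
[cite: Balaban1985BackgroundPropagators, Thm 3.11 p.416 «(Q′G′²Q′*)⁻¹ … positive definite», (3.132) p.422] -/
theorem coercive_K_of_energyRightInverse (hp : PosOnto F n K h c₀ cB a Δx U₀) (hΔs : (Δx U₀).IsSymmetric) {CE : ℝ} (hCE : 0 < CE)
    (E : WL2 ℂ (fun _ : PBond (F.P n) 0 => cB) W₂ → BondL2K ℂ 3 (periodsT3 F K) c₀ W₂) (hQE : ∀ c, Qk F n K h c₀ cB U₀ (E c) = c)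
    (hEE : ∀ c, RCLike.re ⟪E c, laplaceA F n K h c₀ cB a Δx U₀ (E c)⟫_ℂ ≤ CE * ‖c‖ ^ 2) (c : WL2 ℂ (fun _ : PBond (F.P n) 0 => cB) W₂) :
    CE⁻¹ * ‖c‖ ^ 2 ≤ RCLike.re ⟪c, Qk F n K h c₀ cB U₀ (GT F n K h c₀ cB a Δx U₀ (LinearMap.adjoint (Qk F n K h c₀ cB U₀) c))⟫_ℂ := by
  have h4 := norm_pow_four_le_re_inner_K_mul_energy hp hΔs c (E c) (hQE c)
  have hK0 := re_inner_K_nonneg hp hΔs c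
  set r := RCLike.re ⟪c, Qk F n K h c₀ cB U₀ (GT F n K h c₀ cB a Δx U₀ (LinearMap.adjoint (Qk F n K h c₀ cB U₀) c))⟫_ℂ with hr
  by_cases hc : c = 0
  · rw [hc, norm_zero]
    have : r = 0 := by rw [hr, hc, inner_zero_left, map_zero]
    rw [this]; simp
  · have hcpos : 0 < ‖c‖ ^ 2 := by positivity
    have h5 : ‖c‖ ^ 4 ≤ r * (CE * ‖c‖ ^ 2) := h4.trans (mul_le_mul_of_nonneg_left (hEE c) hK0)
    have h6 : ‖c‖ ^ 2 * ‖c‖ ^ 2 ≤ (r * CE) * ‖c‖ ^ 2 := by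
      calc ‖c‖ ^ 2 * ‖c‖ ^ 2 = ‖c‖ ^ 4 := by ring
        _ ≤ r * (CE * ‖c‖ ^ 2) := h5
        _ = (r * CE) * ‖c‖ ^ 2 := by ring
    have h7 : ‖c‖ ^ 2 ≤ r * CE := le_of_mul_le_mul_right h6 hcpos
    calc CE⁻¹ * ‖c‖ ^ 2 ≤ CE⁻¹ * (r * CE) := mul_le_mul_of_nonneg_left h7 (inv_pos.mpr hCE).le
      _ = r := by field_simp

/-- ★★★ **THE BOUND OF `K⁻¹ = (Q_kGQ_k*)⁻¹` FROM AN ENERGY-BOUNDED RIGHT INVERSE OF `Q_k`: `‖K⁻¹ω‖ ≤ C_E‖ω‖`** — coercivity (previous row) + `KK⁻¹ = 1` (✓`Qk_GT_adjoint_KinvT`) through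
✓`inv_bound_of_coercive`. Print's `‖(QGQ*)⁻¹‖ = O(1)` in A-units ((3.132) on the diagonal). [cite: Balaban1985BackgroundPropagators, (3.132) p.422, (3.126) p.420] -/
theorem norm_KinvT_le_of_energyRightInverse (hp : PosOnto F n K h c₀ cB a Δx U₀) (hΔs : (Δx U₀).IsSymmetric) {CE : ℝ} (hCE : 0 < CE)
    (E : WL2 ℂ (fun _ : PBond (F.P n) 0 => cB) W₂ → BondL2K ℂ 3 (periodsT3 F K) c₀ W₂) (hQE : ∀ c, Qk F n K h c₀ cB U₀ (E c) = c)
    (hEE : ∀ c, RCLike.re ⟪E c, laplaceA F n K h c₀ cB a Δx U₀ (E c)⟫_ℂ ≤ CE * ‖c‖ ^ 2) (ω : WL2 ℂ (fun _ : PBond (F.P n) 0 => cB) W₂) :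
    ‖KinvT F n K h c₀ cB a Δx U₀ ω‖ ≤ CE * ‖ω‖ := by
  have hco := coercive_K_of_energyRightInverse hp hΔs hCE E hQE hEE
  have h1 := inv_bound_of_coercive (Qk F n K h c₀ cB U₀ ∘ₗ GT F n K h c₀ cB a Δx U₀ ∘ₗ LinearMap.adjoint (Qk F n K h c₀ cB U₀)) (inv_pos.mpr hCE)
    (fun y => by simpa only [LinearMap.comp_apply] using hco y) (KinvT F n K h c₀ cB a Δx U₀ ω)
  rw [inv_inv, LinearMap.comp_apply, LinearMap.comp_apply, Qk_GT_adjoint_KinvT hp] at h1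
  exact h1

/-! ## §2 `⟨ω, K⁻¹ω⟩` is the `Δ_a`-energy of the minimiser `Hω`, and is below the energy of every interpolant -/

/-- **`Δ_a(Hω) = Q_k†(K⁻¹ω)`** on the class (`H = GQ†K⁻¹`, `Δ_aG = 1`). [cite: Balaban1985BackgroundPropagators, (3.126)–(3.127) pp.420–421] -/
theorem laplaceA_HT_eq (hp : PosOnto F n K h c₀ cB a Δx U₀) (ω : WL2 ℂ (fun _ : PBond (F.P n) 0 => cB) W₂) :
    laplaceA F n K h c₀ cB a Δx U₀ (HT F n K h c₀ cB a Δx U₀ ω) = LinearMap.adjoint (Qk F n K h c₀ cB U₀) (KinvT F n K h c₀ cB a Δx U₀ ω) := by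
  rw [HT_eq_comp hp, LinearMap.comp_apply, LinearMap.comp_apply, laplaceA_GT hp]

/-- ★ **`⟨Hω, Δ_a(Hω)⟩ = ⟨ω, K⁻¹ω⟩`** (as complex numbers): `⟨Hω, Q†K⁻¹ω⟩ = ⟨QHω, K⁻¹ω⟩ = ⟨ω, K⁻¹ω⟩` (✓`Qk_HT`). [cite: Balaban1985BackgroundPropagators, (3.126)–(3.127) pp.420–421; Balaban1985Variational, (45)–(46) p.285] -/
theorem inner_HT_laplaceA_HT_eq (hp : PosOnto F n K h c₀ cB a Δx U₀) (ω : WL2 ℂ (fun _ : PBond (F.P n) 0 => cB) W₂) :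
    ⟪HT F n K h c₀ cB a Δx U₀ ω, laplaceA F n K h c₀ cB a Δx U₀ (HT F n K h c₀ cB a Δx U₀ ω)⟫_ℂ = ⟪ω, KinvT F n K h c₀ cB a Δx U₀ ω⟫_ℂ := by
  rw [laplaceA_HT_eq hp, LinearMap.adjoint_inner_right, Qk_HT hp]

/-- **`re⟨ω, K⁻¹ω⟩ = re⟨Hω, Δ_a(Hω)⟩`.** [cite: Balaban1985BackgroundPropagators, (3.126)–(3.127) pp.420–421] -/
theorem re_inner_KinvT_eq_energy_HT (hp : PosOnto F n K h c₀ cB a Δx U₀) (ω : WL2 ℂ (fun _ : PBond (F.P n) 0 => cB) W₂) :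
    RCLike.re ⟪ω, KinvT F n K h c₀ cB a Δx U₀ ω⟫_ℂ = RCLike.re ⟪HT F n K h c₀ cB a Δx U₀ ω, laplaceA F n K h c₀ cB a Δx U₀ (HT F n K h c₀ cB a Δx U₀ ω)⟫_ℂ := by
  rw [inner_HT_laplaceA_HT_eq hp]

/-- **`0 ≤ re⟨ω, K⁻¹ω⟩`** (it is a `Δ_a`-energy). [cite: Balaban1985BackgroundPropagators, Thm 3.11 p.416] -/
theorem re_inner_KinvT_nonneg (hp : PosOnto F n K h c₀ cB a Δx U₀) (hΔs : (Δx U₀).IsSymmetric) (ω : WL2 ℂ (fun _ : PBond (F.P n) 0 => cB) W₂) :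
    0 ≤ RCLike.re ⟪ω, KinvT F n K h c₀ cB a Δx U₀ ω⟫_ℂ := by
  rw [re_inner_KinvT_eq_energy_HT hp, ← (laplaceA_isSymmetric (F := F) (n := n) (K := K) (h := h) (c₀ := c₀) (cB := cB) (a := a) (Δx := Δx) hΔs) _ _]
  exact (laplaceA_isPositive hp hΔs).2 _

/-- ★★ **MINIMALITY: `re⟨ω, K⁻¹ω⟩ ≤ re⟨A, Δ_aA⟩` FOR EVERY `A` WITH `Q_kA = ω`** — `Hω` minimises the `Δ_a`-energy among the interpolants of `ω` (print p.420); by Cauchy–Schwarz for the form of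
`Δ_a` with `w := Hω`, `g := Q†K⁻¹ω`: `|⟨K⁻¹ω, ω⟩|² ≤ re⟨ω, K⁻¹ω⟩·re⟨A, Δ_aA⟩`. [cite: Balaban1985BackgroundPropagators, (3.125)–(3.127) pp.420–421; Balaban1984PropagatorsI, (1.47)–(1.50) p.26] -/
theorem re_inner_KinvT_le_energy (hp : PosOnto F n K h c₀ cB a Δx U₀) (hΔs : (Δx U₀).IsSymmetric) (ω : WL2 ℂ (fun _ : PBond (F.P n) 0 => cB) W₂)
    (A : BondL2K ℂ 3 (periodsT3 F K) c₀ W₂) (hA : Qk F n K h c₀ cB U₀ A = ω) :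
    RCLike.re ⟪ω, KinvT F n K h c₀ cB a Δx U₀ ω⟫_ℂ ≤ RCLike.re ⟪A, laplaceA F n K h c₀ cB a Δx U₀ A⟫_ℂ := by
  have hcs := norm_inner_sq_le_of_apply_eq (laplaceA_isPositive hp hΔs) (laplaceA_HT_eq hp ω) A
  have e1 : ⟪LinearMap.adjoint (Qk F n K h c₀ cB U₀) (KinvT F n K h c₀ cB a Δx U₀ ω), A⟫_ℂ = ⟪KinvT F n K h c₀ cB a Δx U₀ ω, ω⟫_ℂ := by
    rw [LinearMap.adjoint_inner_left, hA]
  have e2 : RCLike.re ⟪HT F n K h c₀ cB a Δx U₀ ω, LinearMap.adjoint (Qk F n K h c₀ cB U₀) (KinvT F n K h c₀ cB a Δx U₀ ω)⟫_ℂ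
      = RCLike.re ⟪ω, KinvT F n K h c₀ cB a Δx U₀ ω⟫_ℂ := by
    rw [← laplaceA_HT_eq hp ω, inner_HT_laplaceA_HT_eq hp]
  have e3 : RCLike.re ⟪laplaceA F n K h c₀ cB a Δx U₀ A, A⟫_ℂ = RCLike.re ⟪A, laplaceA F n K h c₀ cB a Δx U₀ A⟫_ℂ := inner_re_symm _ _
  rw [e1, e2, e3] at hcs
  set r := RCLike.re ⟪ω, KinvT F n K h c₀ cB a Δx U₀ ω⟫_ℂ with hr
  have hE : 0 ≤ RCLike.re ⟪A, laplaceA F n K h c₀ cB a Δx U₀ A⟫_ℂ := by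
    rw [← e3]; exact (laplaceA_isPositive hp hΔs).2 A
  have hrle : r ≤ ‖⟪KinvT F n K h c₀ cB a Δx U₀ ω, ω⟫_ℂ‖ := by
    rw [hr, inner_re_symm]; exact RCLike.re_le_norm _
  by_cases hr0 : r ≤ 0
  · exact hr0.trans hE
  · have hr0 : 0 < r := lt_of_not_ge hr0
    have h2 : r ^ 2 ≤ r * RCLike.re ⟪A, laplaceA F n K h c₀ cB a Δx U₀ A⟫_ℂ := (pow_le_pow_left₀ hr0.le hrle 2).trans hcs
    nlinarith

/-- **`re⟨ω, K⁻¹ω⟩ ≤ C_E‖ω‖²` from an energy-bounded right inverse** (minimality tested on `A := Eω`). [cite: Balaban1985BackgroundPropagators, (3.132) p.422] -/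
theorem re_inner_KinvT_le_of_energyRightInverse (hp : PosOnto F n K h c₀ cB a Δx U₀) (hΔs : (Δx U₀).IsSymmetric) {CE : ℝ}
    (E : WL2 ℂ (fun _ : PBond (F.P n) 0 => cB) W₂ → BondL2K ℂ 3 (periodsT3 F K) c₀ W₂) (hQE : ∀ c, Qk F n K h c₀ cB U₀ (E c) = c)
    (hEE : ∀ c, RCLike.re ⟪E c, laplaceA F n K h c₀ cB a Δx U₀ (E c)⟫_ℂ ≤ CE * ‖c‖ ^ 2) (ω : WL2 ℂ (fun _ : PBond (F.P n) 0 => cB) W₂) :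
    RCLike.re ⟪ω, KinvT F n K h c₀ cB a Δx U₀ ω⟫_ℂ ≤ CE * ‖ω‖ ^ 2 :=
  (re_inner_KinvT_le_energy hp hΔs ω (E ω) (hQE ω)).trans (hEE ω)

/-! ## §3 The three-term split of `⟨ω, K⁻¹ω⟩` and (3.137)'s form `re⟨ω, (K⁻¹ − a)ω⟩ = re⟨Hω, ΔxHω⟩` -/

/-- ★ **`re⟨ω, K⁻¹ω⟩ = re⟨Hω, Δx(U₀)Hω⟩ + ‖R_SD*Hω‖² + a‖ω‖²`** — ✓`re_inner_laplaceA_eq` at `y := Hω` with `Q_kHω = ω`. [cite: Balaban1985BackgroundPropagators, (3.26) p.395, (3.126)–(3.127) pp.420–421] -/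
theorem re_inner_KinvT_eq_three_terms (hp : PosOnto F n K h c₀ cB a Δx U₀) (ω : WL2 ℂ (fun _ : PBond (F.P n) 0 => cB) W₂) :
    RCLike.re ⟪ω, KinvT F n K h c₀ cB a Δx U₀ ω⟫_ℂ
      = RCLike.re ⟪HT F n K h c₀ cB a Δx U₀ ω, Δx U₀ (HT F n K h c₀ cB a Δx U₀ ω)⟫_ℂ
        + ‖RS F n K h c₀ cB U₀ (DstarL2 F n K c₀ U₀ (HT F n K h c₀ cB a Δx U₀ ω))‖ ^ 2 + a * ‖ω‖ ^ 2 := by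
  rw [re_inner_KinvT_eq_energy_HT hp, re_inner_laplaceA_eq, Qk_HT hp]

/-- **(3.124) KILLS THE GAUGE PENALTY OF THE MINIMISER: `R_SD*(Hω) = 0`** when the Hessian slot is symmetric and kills `D N_S` (✓`RS_DstarL2_GT_adjoint_Qk`, `H = GQ†K⁻¹`).
[cite: Balaban1985BackgroundPropagators, (3.124) p.420] -/
theorem RS_DstarL2_HT_eq_zero (hp : PosOnto F n K h c₀ cB a Δx U₀) (hΔs : (Δx U₀).IsSymmetric) (hΔ : ∀ l ∈ NS F n K h c₀ cB U₀, Δx U₀ (DL2 F n K c₀ U₀ l) = 0)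
    (ω : WL2 ℂ (fun _ : PBond (F.P n) 0 => cB) W₂) :
    RS F n K h c₀ cB U₀ (DstarL2 F n K c₀ U₀ (HT F n K h c₀ cB a Δx U₀ ω)) = 0 := by
  rw [HT_eq_comp hp, LinearMap.comp_apply, LinearMap.comp_apply]
  exact RS_DstarL2_GT_adjoint_Qk hp hΔs hΔ _

/-- ★★ **(3.137)'s FORM: `re⟨ω, K⁻¹ω⟩ − a‖ω‖² = re⟨Hω, Δx(U₀)Hω⟩`** under (3.124) — the operator `K⁻¹ − a` of `Δ_πH = Q†(QGQ*)⁻¹ − Q†a` is the `Δx`-energy form of the minimisers.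
[cite: Balaban1985BackgroundPropagators, (3.137) p.423, (3.124) p.420] -/
theorem re_inner_KinvT_sub_penalty_eq (hp : PosOnto F n K h c₀ cB a Δx U₀) (hΔs : (Δx U₀).IsSymmetric) (hΔ : ∀ l ∈ NS F n K h c₀ cB U₀, Δx U₀ (DL2 F n K c₀ U₀ l) = 0)
    (ω : WL2 ℂ (fun _ : PBond (F.P n) 0 => cB) W₂) :
    RCLike.re ⟪ω, KinvT F n K h c₀ cB a Δx U₀ ω⟫_ℂ - a * ‖ω‖ ^ 2 = RCLike.re ⟪HT F n K h c₀ cB a Δx U₀ ω, Δx U₀ (HT F n K h c₀ cB a Δx U₀ ω)⟫_ℂ := by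
  rw [re_inner_KinvT_eq_three_terms hp ω, RS_DstarL2_HT_eq_zero hp hΔs hΔ ω, norm_zero]
  ring

/-- ★ **`a‖ω‖² ≤ re⟨ω, K⁻¹ω⟩` WHEN THE HESSIAN SLOT IS NON-NEGATIVE** (`K⁻¹ ≥ a`: the two other terms of the split are `≥ 0`). [cite: Balaban1985BackgroundPropagators, (3.132) p.422, (3.137) p.423] -/
theorem penalty_mul_normSq_le_re_inner_KinvT (hp : PosOnto F n K h c₀ cB a Δx U₀) (hΔx : ∀ x, 0 ≤ RCLike.re ⟪x, Δx U₀ x⟫_ℂ)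
    (ω : WL2 ℂ (fun _ : PBond (F.P n) 0 => cB) W₂) :
    a * ‖ω‖ ^ 2 ≤ RCLike.re ⟪ω, KinvT F n K h c₀ cB a Δx U₀ ω⟫_ℂ := by
  rw [re_inner_KinvT_eq_three_terms hp ω]
  nlinarith [hΔx (HT F n K h c₀ cB a Δx U₀ ω), sq_nonneg ‖RS F n K h c₀ cB U₀ (DstarL2 F n K c₀ U₀ (HT F n K h c₀ cB a Δx U₀ ω))‖]

/-- ★ **`‖Kc‖ ≤ a⁻¹‖c‖` WHEN THE HESSIAN SLOT IS NON-NEGATIVE AND `0 < a`** (print: `QGQ* ≤ a⁻¹`): the previous row through ✓`inv_bound_of_coercive` at `T := K⁻¹`, `y := Kc`, with `K⁻¹(Kc) = c`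
(`K⁻¹` is a two-sided inverse in finite dimension: `K(K⁻¹(Kc)) = Kc` and `K` is injective by the coercivity-free identity `K⁻¹K = 1` obtained from `KK⁻¹ = 1`).
[cite: Balaban1985BackgroundPropagators, (3.132) p.422, (3.126) p.420] -/
theorem norm_K_le_of_nonneg (hp : PosOnto F n K h c₀ cB a Δx U₀) (hΔx : ∀ x, 0 ≤ RCLike.re ⟪x, Δx U₀ x⟫_ℂ) (ha : 0 < a)
    (c : WL2 ℂ (fun _ : PBond (F.P n) 0 => cB) W₂) :
    ‖Qk F n K h c₀ cB U₀ (GT F n K h c₀ cB a Δx U₀ (LinearMap.adjoint (Qk F n K h c₀ cB U₀) c))‖ ≤ a⁻¹ * ‖c‖ := by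
  -- `K⁻¹` is a left inverse too: `K` is surjective (right inverse `K⁻¹`), hence injective (finite dimension), and `K(K⁻¹(Kc)) = Kc`
  set Kop : WL2 ℂ (fun _ : PBond (F.P n) 0 => cB) W₂ →ₗ[ℂ] WL2 ℂ (fun _ : PBond (F.P n) 0 => cB) W₂ :=
    Qk F n K h c₀ cB U₀ ∘ₗ GT F n K h c₀ cB a Δx U₀ ∘ₗ LinearMap.adjoint (Qk F n K h c₀ cB U₀) with hKop
  have hright : ∀ y, Kop (KinvT F n K h c₀ cB a Δx U₀ y) = y := fun y => by
    rw [hKop, LinearMap.comp_apply, LinearMap.comp_apply]; exact Qk_GT_adjoint_KinvT hp y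
  have hsurj : Function.Surjective Kop := fun y => ⟨_, hright y⟩
  have hinj : Function.Injective Kop := LinearMap.injective_iff_surjective.mpr hsurj
  have hleft : KinvT F n K h c₀ cB a Δx U₀ (Kop c) = c := hinj (hright (Kop c))
  have h1 := inv_bound_of_coercive (KinvT F n K h c₀ cB a Δx U₀) ha (penalty_mul_normSq_le_re_inner_KinvT hp hΔx) (Kop c)
  rw [hleft] at h1
  have e : Kop c = Qk F n K h c₀ cB U₀ (GT F n K h c₀ cB a Δx U₀ (LinearMap.adjoint (Qk F n K h c₀ cB U₀) c)) := by
    rw [hKop, LinearMap.comp_apply, LinearMap.comp_apply]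
  rw [e] at h1
  exact h1

/-! ## §4 From an APPROXIMATE smooth right inverse to an EXACT one, correcting on the COARSE side (no `Q_k†`, so no energy loss) -/

section CoarseCorrection

variable {C : Type*} [NormedAddCommGroup C] [InnerProductSpace ℂ C] [FiniteDimensional ℂ C] {V : Type*} [AddCommGroup V] [Module ℂ V]

/-- **A LINEAR MAP WITH `‖Tc − c‖ ≤ ½‖c‖` IS INVERTIBLE WITH `‖T⁻¹c‖ ≤ 2‖c‖`** (finite dimension: `‖Tc‖ ≥ ½‖c‖` makes `T` injective, hence bijective). [folklore] -/
theorem exists_inverse_of_norm_sub_le_half (T : C →ₗ[ℂ] C) (hT : ∀ c, ‖T c - c‖ ≤ (1 / 2) * ‖c‖) :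
    ∃ N : C →ₗ[ℂ] C, (∀ c, T (N c) = c) ∧ (∀ c, N (T c) = c) ∧ ∀ c, ‖N c‖ ≤ 2 * ‖c‖ := by
  have hlow : ∀ c, (1 / 2) * ‖c‖ ≤ ‖T c‖ := fun c => by
    have h1 : ‖c‖ ≤ ‖T c‖ + ‖T c - c‖ := by
      calc ‖c‖ = ‖T c - (T c - c)‖ := by rw [sub_sub_cancel]
        _ ≤ ‖T c‖ + ‖T c - c‖ := norm_sub_le _ _
    linarith [hT c]
  have hinj : Function.Injective T := by
    intro x y hxy
    have h0 : T (x - y) = 0 := by rw [map_sub, hxy, sub_self]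
    have h1 := hlow (x - y)
    rw [h0, norm_zero] at h1
    have : ‖x - y‖ = 0 := by linarith [norm_nonneg (x - y)]
    exact sub_eq_zero.mp (norm_eq_zero.mp this)
  have hbij : Function.Bijective T := ⟨hinj, LinearMap.injective_iff_surjective.mp hinj⟩
  let e : C ≃ₗ[ℂ] C := LinearEquiv.ofBijective T hbij
  refine ⟨(e.symm : C →ₗ[ℂ] C), fun c => ?_, fun c => ?_, fun c => ?_⟩
  · exact e.apply_symm_apply c
  · exact e.symm_apply_apply c
  · have h1 := hlow (e.symm c)
    have h2 : T (e.symm c) = c := e.apply_symm_apply c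
    rw [h2] at h1
    change ‖e.symm c‖ ≤ 2 * ‖c‖
    linarith

/-- ★★ **EXACT RIGHT INVERSE FROM AN APPROXIMATE ONE, ENERGY KEPT**: if a linear `E₀ : C → V` has `‖Q(E₀c) − c‖ ≤ ½‖c‖` and a quadratic-type bound `𝓔(E₀c) ≤ C₀‖c‖²` for some
`𝓔 : V → ℝ` (e.g. `re⟨·, Δ_a ·⟩`), then `E := E₀ ∘ (QE₀)⁻¹` is an EXACT right inverse of `Q` with `𝓔(Ec) ≤ 4C₀‖c‖²` — the correction acts on the coarse side, so the block-constant
`Q†` (whose derivative energy is `O(η⁻¹)`) never enters. At the member: `E₀` = the flat smooth interpolant (✓`exists_smoothRightInverse_bondAvgIter_T3`-class), `Q = Q_k(U₀)` close to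
`Q_k(1)` on `RegPr`. [cite: Balaban1984PropagatorsI, (1.47)–(1.50) p.26; Balaban1985BackgroundPropagators, (3.19) p.393] -/
theorem exists_exact_rightInverse_of_approx (Q : V →ₗ[ℂ] C) (E₀ : C →ₗ[ℂ] V) (hQE : ∀ c, ‖Q (E₀ c) - c‖ ≤ (1 / 2) * ‖c‖)
    (𝓔 : V → ℝ) {C₀ : ℝ} (hC₀ : 0 ≤ C₀) (hE₀ : ∀ c, 𝓔 (E₀ c) ≤ C₀ * ‖c‖ ^ 2) :
    ∃ E : C →ₗ[ℂ] V, (∀ c, Q (E c) = c) ∧ ∀ c, 𝓔 (E c) ≤ 4 * C₀ * ‖c‖ ^ 2 := by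
  obtain ⟨N, hTN, -, hN⟩ := exists_inverse_of_norm_sub_le_half (Q ∘ₗ E₀) (fun c => by simpa only [LinearMap.comp_apply] using hQE c)
  refine ⟨E₀ ∘ₗ N, fun c => ?_, fun c => ?_⟩
  · have h1 := hTN c
    rwa [LinearMap.comp_apply] at h1
  · rw [LinearMap.comp_apply]
    refine (hE₀ (N c)).trans ?_
    have h2 : ‖N c‖ ^ 2 ≤ (2 * ‖c‖) ^ 2 := pow_le_pow_left₀ (norm_nonneg _) (hN c) 2
    nlinarith

end CoarseCorrection

/-- ★★★ **THE BOUND OF `K⁻¹` FROM AN APPROXIMATE SMOOTH INTERPOLANT**: a linear `E₀` with `‖Q_k(E₀c) − c‖ ≤ ½‖c‖` and `re⟨E₀c, Δ_a(E₀c)⟩ ≤ C₀‖c‖²` (`0 < C₀`) gives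
`‖K⁻¹ω‖ ≤ 4C₀‖ω‖` and the coercivity `(4C₀)⁻¹‖c‖² ≤ re⟨c, Kc⟩` — §4 ∘ §1. [cite: Balaban1985BackgroundPropagators, (3.132) p.422; Balaban1984PropagatorsI, (1.47)–(1.50) p.26] -/
theorem norm_KinvT_le_of_approxRightInverse (hp : PosOnto F n K h c₀ cB a Δx U₀) (hΔs : (Δx U₀).IsSymmetric) {C₀ : ℝ} (hC₀ : 0 < C₀)
    (E₀ : WL2 ℂ (fun _ : PBond (F.P n) 0 => cB) W₂ →ₗ[ℂ] BondL2K ℂ 3 (periodsT3 F K) c₀ W₂) (hQE : ∀ c, ‖Qk F n K h c₀ cB U₀ (E₀ c) - c‖ ≤ (1 / 2) * ‖c‖)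
    (hE₀ : ∀ c, RCLike.re ⟪E₀ c, laplaceA F n K h c₀ cB a Δx U₀ (E₀ c)⟫_ℂ ≤ C₀ * ‖c‖ ^ 2) (ω : WL2 ℂ (fun _ : PBond (F.P n) 0 => cB) W₂) :
    ‖KinvT F n K h c₀ cB a Δx U₀ ω‖ ≤ 4 * C₀ * ‖ω‖
      ∧ (4 * C₀)⁻¹ * ‖ω‖ ^ 2 ≤ RCLike.re ⟪ω, Qk F n K h c₀ cB U₀ (GT F n K h c₀ cB a Δx U₀ (LinearMap.adjoint (Qk F n K h c₀ cB U₀) ω))⟫_ℂ := by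
  obtain ⟨E, hQE', hEE⟩ := exists_exact_rightInverse_of_approx (Qk F n K h c₀ cB U₀) E₀ hQE
    (fun v => RCLike.re ⟪v, laplaceA F n K h c₀ cB a Δx U₀ v⟫_ℂ) hC₀.le hE₀
  have h4 : 0 < 4 * C₀ := by positivity
  exact ⟨norm_KinvT_le_of_energyRightInverse hp hΔs h4 E hQE' hEE ω, coercive_K_of_energyRightInverse hp hΔs h4 E hQE' hEE ω⟩

end Summit.QuantumFields.YangMills.Theorems.Prop7KinvVariationalRows

end
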